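import Summits.CriticalPhenomena.PercolationContinuityZ3.Theorems.Transplant.FKConnectivityAllQPat3CutMarked
import Summits.CriticalPhenomena.PercolationContinuityZ3.Theorems.Transplant.FKConnectivityAllQPat3FastCheck
import HarnessLib

/-!
# Connectivity correlation inequalities for `φ_{w,q}`, every `q > 0` — THEOREM 3C DATA, the MARKED 1-CUT for `mirror2 starXTab`
# (0 products, denominator 1; unconditional)

Theorems + data file (`--supports stmt-CriticalPhenomena-4575`), census lane `prim-bschramm-census` (gen 36) of the post-continuity programme (LANE 2 bschramm, FK sub-lane);
builds on p205010 (kernel theorem, internal audit signed; external expert review pending).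
No named facts, no sorries; standard axioms (`decide +kernel` only).  **`FK.cutSStarY_level_nonneg`**: when the mark `s` is a cut
vertex separating the marks `x` and `y`, `mirror2 starXTab` is levelwise nonnegative on `(x, y, s)` — any graphs on the two sides.
[cite: AyyerLinussonRavichandran2025, §7 eq. (13)–(15) (p. 22)] [cite: Grimmett2006, §3.8 (pp. 61–62)]
-/

noncomputable section

namespace Summit.CriticalPhenomena.PercolationContinuityZ3.Theorems

namespace FK

open SimpleGraph Literature.Probability.LatticeModels Literature.Probability.Percolation

section Data

/- Sequential elaboration of the kernel evaluations (memory on the smaller farm nodes). -/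
set_option Elab.async false

open scoped Classical

variable {V : Type*} [Fintype V]

/-- The 0 products of the MARKED-1-CUT certificate for the target `mirror2 starXTab` (denominator `1`; bit indicators on both sides). [folklore] -/
def prodsCutSStarY : List Prod3 :=
  []

/-- The symmetrised target function (MARKED-1-CUT join, third pair ignored). [folklore] -/
abbrev tauCutSStarY : ℕ → Pat3 → Pat3 → Pat3 → Pat3 → Pat3 → Pat3 → ℤ := target3SymF joinS3 corrR3 (mirror2 starXTab)

/-- The shifts are at most `0`. [folklore] -/
theorem cutSStarY_shift : (prodsCutSStarY.all fun p => decide (p.shift ≤ 0)) = true := by decide +kernel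

/-- Pair `(all, all)` of the CutSStarY certificate check (kernel evaluation). [folklore] -/
theorem cutSStarY_pair_all_all : loop1G tauCutSStarY 8 1 0 (prodsCutSStarY.filter fun p => suppAt p.gK Pat3.all Pat3.all) Pat3.all Pat3.all = true := by
  decide +kernel

/-- Pair `(all, xy_s)` of the CutSStarY certificate check (kernel evaluation). [folklore] -/
theorem cutSStarY_pair_all_xy_s : loop1G tauCutSStarY 8 1 0 (prodsCutSStarY.filter fun p => suppAt p.gK Pat3.all Pat3.xy_s) Pat3.all Pat3.xy_s = true := by
  decide +kernel

/-- Pair `(all, xs_y)` of the CutSStarY certificate check (kernel evaluation). [folklore] -/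
theorem cutSStarY_pair_all_xs_y : loop1G tauCutSStarY 8 1 0 (prodsCutSStarY.filter fun p => suppAt p.gK Pat3.all Pat3.xs_y) Pat3.all Pat3.xs_y = true := by
  decide +kernel

/-- Pair `(all, ys_x)` of the CutSStarY certificate check (kernel evaluation). [folklore] -/
theorem cutSStarY_pair_all_ys_x : loop1G tauCutSStarY 8 1 0 (prodsCutSStarY.filter fun p => suppAt p.gK Pat3.all Pat3.ys_x) Pat3.all Pat3.ys_x = true := by
  decide +kernel

/-- Pair `(all, sep)` of the CutSStarY certificate check (kernel evaluation). [folklore] -/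
theorem cutSStarY_pair_all_sep : loop1G tauCutSStarY 8 1 0 (prodsCutSStarY.filter fun p => suppAt p.gK Pat3.all Pat3.sep) Pat3.all Pat3.sep = true := by
  decide +kernel

/-- Pair `(xy_s, all)` of the CutSStarY certificate check (kernel evaluation). [folklore] -/
theorem cutSStarY_pair_xy_s_all : loop1G tauCutSStarY 8 1 0 (prodsCutSStarY.filter fun p => suppAt p.gK Pat3.xy_s Pat3.all) Pat3.xy_s Pat3.all = true := by
  decide +kernel

/-- Pair `(xy_s, xy_s)` of the CutSStarY certificate check (kernel evaluation). [folklore] -/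
theorem cutSStarY_pair_xy_s_xy_s : loop1G tauCutSStarY 8 1 0 (prodsCutSStarY.filter fun p => suppAt p.gK Pat3.xy_s Pat3.xy_s) Pat3.xy_s Pat3.xy_s = true := by
  decide +kernel

/-- Pair `(xy_s, xs_y)` of the CutSStarY certificate check (kernel evaluation). [folklore] -/
theorem cutSStarY_pair_xy_s_xs_y : loop1G tauCutSStarY 8 1 0 (prodsCutSStarY.filter fun p => suppAt p.gK Pat3.xy_s Pat3.xs_y) Pat3.xy_s Pat3.xs_y = true := by
  decide +kernel

/-- Pair `(xy_s, ys_x)` of the CutSStarY certificate check (kernel evaluation). [folklore] -/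
theorem cutSStarY_pair_xy_s_ys_x : loop1G tauCutSStarY 8 1 0 (prodsCutSStarY.filter fun p => suppAt p.gK Pat3.xy_s Pat3.ys_x) Pat3.xy_s Pat3.ys_x = true := by
  decide +kernel

/-- Pair `(xy_s, sep)` of the CutSStarY certificate check (kernel evaluation). [folklore] -/
theorem cutSStarY_pair_xy_s_sep : loop1G tauCutSStarY 8 1 0 (prodsCutSStarY.filter fun p => suppAt p.gK Pat3.xy_s Pat3.sep) Pat3.xy_s Pat3.sep = true := by
  decide +kernel

/-- Pair `(xs_y, all)` of the CutSStarY certificate check (kernel evaluation). [folklore] -/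
theorem cutSStarY_pair_xs_y_all : loop1G tauCutSStarY 8 1 0 (prodsCutSStarY.filter fun p => suppAt p.gK Pat3.xs_y Pat3.all) Pat3.xs_y Pat3.all = true := by
  decide +kernel

/-- Pair `(xs_y, xy_s)` of the CutSStarY certificate check (kernel evaluation). [folklore] -/
theorem cutSStarY_pair_xs_y_xy_s : loop1G tauCutSStarY 8 1 0 (prodsCutSStarY.filter fun p => suppAt p.gK Pat3.xs_y Pat3.xy_s) Pat3.xs_y Pat3.xy_s = true := by
  decide +kernel

/-- Pair `(xs_y, xs_y)` of the CutSStarY certificate check (kernel evaluation). [folklore] -/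
theorem cutSStarY_pair_xs_y_xs_y : loop1G tauCutSStarY 8 1 0 (prodsCutSStarY.filter fun p => suppAt p.gK Pat3.xs_y Pat3.xs_y) Pat3.xs_y Pat3.xs_y = true := by
  decide +kernel

/-- Pair `(xs_y, ys_x)` of the CutSStarY certificate check (kernel evaluation). [folklore] -/
theorem cutSStarY_pair_xs_y_ys_x : loop1G tauCutSStarY 8 1 0 (prodsCutSStarY.filter fun p => suppAt p.gK Pat3.xs_y Pat3.ys_x) Pat3.xs_y Pat3.ys_x = true := by
  decide +kernel

/-- Pair `(xs_y, sep)` of the CutSStarY certificate check (kernel evaluation). [folklore] -/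
theorem cutSStarY_pair_xs_y_sep : loop1G tauCutSStarY 8 1 0 (prodsCutSStarY.filter fun p => suppAt p.gK Pat3.xs_y Pat3.sep) Pat3.xs_y Pat3.sep = true := by
  decide +kernel

/-- Pair `(ys_x, all)` of the CutSStarY certificate check (kernel evaluation). [folklore] -/
theorem cutSStarY_pair_ys_x_all : loop1G tauCutSStarY 8 1 0 (prodsCutSStarY.filter fun p => suppAt p.gK Pat3.ys_x Pat3.all) Pat3.ys_x Pat3.all = true := by
  decide +kernel

/-- Pair `(ys_x, xy_s)` of the CutSStarY certificate check (kernel evaluation). [folklore] -/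
theorem cutSStarY_pair_ys_x_xy_s : loop1G tauCutSStarY 8 1 0 (prodsCutSStarY.filter fun p => suppAt p.gK Pat3.ys_x Pat3.xy_s) Pat3.ys_x Pat3.xy_s = true := by
  decide +kernel

/-- Pair `(ys_x, xs_y)` of the CutSStarY certificate check (kernel evaluation). [folklore] -/
theorem cutSStarY_pair_ys_x_xs_y : loop1G tauCutSStarY 8 1 0 (prodsCutSStarY.filter fun p => suppAt p.gK Pat3.ys_x Pat3.xs_y) Pat3.ys_x Pat3.xs_y = true := by
  decide +kernel

/-- Pair `(ys_x, ys_x)` of the CutSStarY certificate check (kernel evaluation). [folklore] -/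
theorem cutSStarY_pair_ys_x_ys_x : loop1G tauCutSStarY 8 1 0 (prodsCutSStarY.filter fun p => suppAt p.gK Pat3.ys_x Pat3.ys_x) Pat3.ys_x Pat3.ys_x = true := by
  decide +kernel

/-- Pair `(ys_x, sep)` of the CutSStarY certificate check (kernel evaluation). [folklore] -/
theorem cutSStarY_pair_ys_x_sep : loop1G tauCutSStarY 8 1 0 (prodsCutSStarY.filter fun p => suppAt p.gK Pat3.ys_x Pat3.sep) Pat3.ys_x Pat3.sep = true := by
  decide +kernel

/-- Pair `(sep, all)` of the CutSStarY certificate check (kernel evaluation). [folklore] -/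
theorem cutSStarY_pair_sep_all : loop1G tauCutSStarY 8 1 0 (prodsCutSStarY.filter fun p => suppAt p.gK Pat3.sep Pat3.all) Pat3.sep Pat3.all = true := by
  decide +kernel

/-- Pair `(sep, xy_s)` of the CutSStarY certificate check (kernel evaluation). [folklore] -/
theorem cutSStarY_pair_sep_xy_s : loop1G tauCutSStarY 8 1 0 (prodsCutSStarY.filter fun p => suppAt p.gK Pat3.sep Pat3.xy_s) Pat3.sep Pat3.xy_s = true := by
  decide +kernel

/-- Pair `(sep, xs_y)` of the CutSStarY certificate check (kernel evaluation). [folklore] -/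
theorem cutSStarY_pair_sep_xs_y : loop1G tauCutSStarY 8 1 0 (prodsCutSStarY.filter fun p => suppAt p.gK Pat3.sep Pat3.xs_y) Pat3.sep Pat3.xs_y = true := by
  decide +kernel

/-- Pair `(sep, ys_x)` of the CutSStarY certificate check (kernel evaluation). [folklore] -/
theorem cutSStarY_pair_sep_ys_x : loop1G tauCutSStarY 8 1 0 (prodsCutSStarY.filter fun p => suppAt p.gK Pat3.sep Pat3.ys_x) Pat3.sep Pat3.ys_x = true := by
  decide +kernel

/-- Pair `(sep, sep)` of the CutSStarY certificate check (kernel evaluation). [folklore] -/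
theorem cutSStarY_pair_sep_sep : loop1G tauCutSStarY 8 1 0 (prodsCutSStarY.filter fun p => suppAt p.gK Pat3.sep Pat3.sep) Pat3.sep Pat3.sep = true := by
  decide +kernel

/-- **The symmetrised certificate family.** [folklore] -/
theorem cutSStarY_cert (d : ℕ) (P1 Q1 P2 Q2 P3 Q3 : Pat3) :
    8 * ∑ j : Fin prodsCutSStarY.length, ((prodsCutSStarY.get j).lam : ℤ) * (prodsCutSStarY.get j).tensor d P1 Q1 P2 Q2 P3 Q3 ≤
      (1 : ℕ) * target3Sym joinS3 corrR3 (mirror2 starXTab) d P1 Q1 P2 Q2 P3 Q3 :=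
  symCert_of_pairs corrR3_le_two 1 0 cutSStarY_shift (fun PK QK => by
    cases PK <;> cases QK
    exacts [cutSStarY_pair_all_all, cutSStarY_pair_all_xy_s, cutSStarY_pair_all_xs_y, cutSStarY_pair_all_ys_x, cutSStarY_pair_all_sep,
      cutSStarY_pair_xy_s_all, cutSStarY_pair_xy_s_xy_s, cutSStarY_pair_xy_s_xs_y, cutSStarY_pair_xy_s_ys_x, cutSStarY_pair_xy_s_sep,
      cutSStarY_pair_xs_y_all, cutSStarY_pair_xs_y_xy_s, cutSStarY_pair_xs_y_xs_y, cutSStarY_pair_xs_y_ys_x, cutSStarY_pair_xs_y_sep,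
      cutSStarY_pair_ys_x_all, cutSStarY_pair_ys_x_xy_s, cutSStarY_pair_ys_x_xs_y, cutSStarY_pair_ys_x_ys_x, cutSStarY_pair_ys_x_sep,
      cutSStarY_pair_sep_all, cutSStarY_pair_sep_xy_s, cutSStarY_pair_sep_xs_y, cutSStarY_pair_sep_ys_x, cutSStarY_pair_sep_sep]) d P1 Q1 P2 Q2 P3 Q3

/-- **THEOREM SP when a mark separates the other two (census g32 §4 `c1_u··`, kernel, UNCONDITIONAL):** if `G = A ∪ B` with
`A, B` edge-disjoint, meeting in the single vertex `s` (a mark), and the other marks `x ∈ A`, `y ∈ B` lie off the other side,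
then `0 ≤ 1 · lev2 G x y s mirror2 starXTab λ` at every level `λ` — for ARBITRARY `A`, `B`. [cite: AyyerLinussonRavichandran2025, §7 (p. 22)] -/
theorem cutSStarY_level_nonneg {E₁ E₂ : Finset (Sym2 V)} {V₁ V₂ : Set V} {x y s : V}
    (hd : Disjoint E₁ E₂) (h₁ : ∀ e ∈ (↑E₁ : Set (Sym2 V)), ∀ z ∈ e, z ∈ V₁)
    (h₂ : ∀ e ∈ (↑E₂ : Set (Sym2 V)), ∀ z ∈ e, z ∈ V₂) (hS : V₁ ∩ V₂ ⊆ ({s} : Set V)) (hxV : x ∉ V₂)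
    (hyV : y ∉ V₁) (hxs : x ≠ s) (hys : y ≠ s) (hxy : x ≠ y)
    (lam : ℕ) : 0 ≤ ((1 : ℕ) : ℤ) * lev2 (E₁ ∪ E₂) x y s (mirror2 starXTab) lam := by
  refine cutS_level_nonneg_of_symCert hd h₁ h₂ hS hxV hyV hxs hys hxy (mirror2 starXTab) 1 Finset.univ
    (fun j => prodsCutSStarY.get j) cutSStarY_cert (fun j _ μ => ?_) lam
  exact (Fin.elim0 j)

end Data

end FK

end Summit.CriticalPhenomena.PercolationContinuityZ3.Theorems

end
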